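/-
Copyright (c) 2026 the pub-hodgecm-mathlib formalisation cell (harness21).  Prover seat hodgecm-mathlib-K2Liu-p13 (g3), Track B «K2-LIT»,
#184♮ = hLiu418 = `stmt-HodgeConjecture-24832`; ROAD Φ (RULING «M-156n»), consumer sheet fa2b1e3a29709f09 row G6-fin — THE BIG-CELL TERM PACKAGE `Ec₈` of socket #41
(★ `K2LiuSiegelEisensteinContinuationTop`) in the 4-clause currency of ★ Φ9 `exists_continuation_package_of_term_packages`, INSTANTIATED: ★ `K2LiuBigCellPackageOfFaces.exists_bigCell_package`
at `X := H(𝔸)`, `height := adelicHeightGL (n+n)`, `BIG s := M(s)f_s`, with the continuity face ★ `K2LiuBigCellContinuous`, the growth face ★ `K2LiuBigCellGrowthOfStandard` (here re-issued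
for the CONTINUED big cell `E` — `hEeq` on the convergence half-plane only, the honest binder) and `χ′ := χʷ` ★∕📤 `K2LiuIntertwiningDeltaReflect`; by-value letters left = the scalar
normalisation `(P, r, G, a)` (Φ8-scalar row) and the continuation `(E, hEd, hEeq)` (factorisation ∕ GK ∕ arch-ladder rows).  THEOREMS ONLY (no `def`, no `instance`, no named-fact hypothesis, no `sorry`).
-/
import Summits.HodgeConjecture.HodgeConjecture.Theorems.K2LiuIntertwiningDeltaReflect        -- ★∕📤 `χ′ := reflectChar c χ`; brings ★ GrowthOfStandard ∕ Assembled ∕ Unconditional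
import Summits.HodgeConjecture.HodgeConjecture.Theorems.K2LiuBigCellPackageOfFaces           -- ★ `exists_bigCell_package`
import Summits.HodgeConjecture.HodgeConjecture.Theorems.K2LiuBigCellContinuous               -- ★ `continuous_intertwiningDelta_family` (`hBc`)
import HarnessLib

/-!
# Crux `HLiu418`, ROAD Φ, organ Φ8 (sheet row G6-fin): THE BIG-CELL TERM PACKAGE `Ec₈ = (∏_{p ∈ P₈}(s − p)) · M(s)f_s`, INSTANTIATED — by-value letters = the scalar
# normalisation and the continuation of the normalised big cell, nothing else

Cell `hodgecm-mathlib`, crux item hLiu418 = `stmt-HodgeConjecture-24832` (helper lane, count-neutral).  GENERIC `n ≠ 0`, doubled frame `H(𝔸) = HA L e dV hdV dW hdW`, a standard family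
`f_s ∈ I(s, χ)` for an Iwasawa datum `𝒦` (`hstd`, `hcont` — socket #41's own binders), `χ` unitary, a Haar measure `νN` on `N_Δ(𝔸)`.
§1 **`bigCell_growth_continued`** ∕ `…_reflect` — the growth face for the CONTINUED normalised big cell: `E : ℂ → H(𝔸) → ℂ` holomorphic in `s` on `{0 < re}` per point (`hEd`) and EQUAL to
`a(s)·M(s)f_s` on the convergence half-plane `re s > n∕2` (`hEeq`) has moderate growth in `adelicHeightGL (n+n)` locally uniformly on `{0 < re}` (★ `growth_of_equivariance_of_pointRepr`:
`heqv` ★ `intertwiningDelta_family_equivariant_of_conj`, `hrep` ★ `intertwiningDelta_translate_repr` — both transported to `E` through `hEeq` — `hIw`∕`hPK`∕`hω`∕`hωd` ★).  (The earlier heads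
★ `bigCell_growth_of_standard` etc. state the same for the literal product `a s · intertwiningDelta νN (f s)`; the present binders are the ones a continuation row actually delivers.)
§2 **`exists_bigCell_termPackage`** — ★ `exists_bigCell_package` at `X := H(𝔸)`: given the scalar normalisation `(P, r, G)` (`(∏_{p∈P}(s−p))·r(s) = G(s)` holomorphic on `{0<re}`,
`r(s)·a(s) = 1` on `re s > n∕2`) and the continuation `(E, hEd, hEeq)` of `a(s)·M(s)f_s`, THERE IS `Ec₈` with (i) holomorphy on `{0<re}`, (ii) continuity in `h` for `0 < re s` (Vitali, ★ faces
file), (iv) `Ec₈ s h = (∏_{p∈P}(s−p))·M(s)f_s(h)` on `re s > n∕2`, (v) growth `‖Ec₈ s h‖ ≤ C·adelicHeightGL(h)^A` locally uniformly — the four clauses the #41 TOP takes per term.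
Sources: [Garrett2018, §3.10–§3.12]; [MoeglinWaldspurger1995, II.1.6–II.1.7, IV.1]; [HarrisKudlaSweet1996, §6]; [KudlaSweet1997, §1]; [Tan1999, §2–§3].
HONEST LABEL.  Helper lemmas, count-neutral; `HC_CM` is proved only modulo the 7 printed citations (2 remaining named inputs:
hLiu418 = `stmt-HodgeConjecture-24832`, h413 = `stmt-HodgeConjecture-24833`) until rung 0 closes.
-/

set_option autoImplicit false
set_option linter.dupNamespace false -- the mandated namespace repeats `HodgeConjecture.HodgeConjecture`

noncomputable section

open scoped Matrix NNReal ENNReal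
open NumberField IsDedekindDomain MeasureTheory MeasureTheory.Measure Metric

namespace Summit.HodgeConjecture.HodgeConjecture.Cruxes.HLiu418.K2LiuSiegelEisensteinBigCellTermPackage

open Literature.NumberTheory.GelbartRogawski1991.AdaptedBlocks
open Literature.NumberTheory.Automorphic Literature.NumberTheory.Automorphic.UnitaryGroup
open Literature.NumberTheory.GelbartRogawski1991 Literature.NumberTheory.GelbartRogawski1991.GRConstruction
open Literature.NumberTheory.K2Lit.SiegelDoubled Literature.NumberTheory.GaloisRepresentations
open UnitaryDualPair
open Summit.HodgeConjecture.HodgeConjecture.Cruxes.HLiu418.K2LiuIntertwiningDeltaUnconditional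
open Summit.HodgeConjecture.HodgeConjecture.Cruxes.HLiu418.K2LiuBigCellGrowthOfEquivariance
open Summit.HodgeConjecture.HodgeConjecture.Cruxes.HLiu418.K2LiuBigCellGrowthAssembled
open Summit.HodgeConjecture.HodgeConjecture.Cruxes.HLiu418.K2LiuBigCellGrowthOfStandard
open Summit.HodgeConjecture.HodgeConjecture.Cruxes.HLiu418.K2LiuIntertwiningDeltaReflect
open Summit.HodgeConjecture.HodgeConjecture.Cruxes.HLiu418.K2LiuBigCellPackageOfFaces (exists_bigCell_package)
open Summit.HodgeConjecture.HodgeConjecture.Cruxes.HLiu418.K2LiuBigCellContinuous (continuous_intertwiningDelta_family)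
open Summit.HodgeConjecture.HodgeConjecture.Cruxes.H413.K2E1CharacterEisensteinU2Defs (reflectChar)

variable (L : Type) [Field L] [NumberField L] [IsCMField L]
variable {N M n : ℕ} (e : Fin N × Fin M ≃ Fin n)
  (dV : Fin N → L) (hdV : ∀ i, IsCMField.complexConj L (dV i) = dV i)
  (dW : Fin M → L) (hdW : ∀ i, IsCMField.complexConj L (dW i) = dW i)

/-! ## §1 The growth face for the CONTINUED normalised big cell -/

/-- **GROWTH OF THE CONTINUED NORMALISED BIG CELL.**  `f_s ∈ I(s, χ)` standard for `𝒦`, each `f_s` continuous, `χ` unitary, `χ′` with `hχ′`; `E s x` holomorphic on `{0 < re}` for every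
`x` and `E s x = a(s)·M(s)f_s(x)` for `re s > n∕2`.  THEN `‖E s x‖ ≤ C·adelicHeightGL(x)^A` locally uniformly on `{0 < re}`.
[cite: Garrett2018, §3.12] [cite: MoeglinWaldspurger1995, IV.1] [cite: HarrisKudlaSweet1996, §6] [cite: KudlaSweet1997, §1] -/
theorem bigCell_growth_continued [NeZero n] (hdV0 : ∀ i, dV i ≠ 0) (hdW0 : ∀ i, dW i ≠ 0) (𝒦 : IwasawaDatum L e dV hdV dW hdW)
    [MeasurableSpace (unipDelta L e dV hdV dW hdW)] [BorelSpace (unipDelta L e dV hdV dW hdW)]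
    (νN : Measure (unipDelta L e dV hdV dW hdW)) [νN.IsHaarMeasure] (χ χ' : HeckeCharacter L) (hχ : χ.IsUnitary)
    (hχ' : ∀ u : (AdeleRing (𝓞 L) L)ˣ,
      χ' u = (χ (Units.map (conjAdele (Fp L) L (IsCMField.complexConj L) : AdeleRing (𝓞 L) L →* AdeleRing (𝓞 L) L) u))⁻¹)
    (f : ℂ → HA L e dV hdV dW hdW → ℂ) (hstd : IsStandardSectionFamily 𝒦 χ f) (hcont : ∀ s, Continuous (f s)) (a : ℂ → ℂ)
    (E : ℂ → HA L e dV hdV dW hdW → ℂ) (hEd : ∀ x : HA L e dV hdV dW hdW, DifferentiableOn ℂ (fun s : ℂ => E s x) {s : ℂ | 0 < s.re})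
    (hEeq : ∀ (s : ℂ) (x : HA L e dV hdV dW hdW), (n : ℝ) / 2 < s.re → E s x = a s * intertwiningDelta L e dV hdV dW hdW νN (f s) x) :
    ∀ z : ℂ, 0 < z.re → ∃ C A ρ : ℝ, 0 ≤ C ∧ 0 ≤ A ∧ 0 < ρ ∧ ∀ s : ℂ, dist s z < ρ → ∀ x : HA L e dV hdV dW hdW,
      ‖E s x‖ ≤ C * adelicHeightGL (n + n) L (x : GL (Fin (n + n)) (AdeleRing (𝓞 L) L)) ^ A := by
  classical
  obtain ⟨CK, hCK, hPK⟩ := exists_hPK L e dV hdV dW hdW (n := n) 𝒦.isCompact_K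
  obtain ⟨T, d, B, hB, hdB, hrep₀⟩ := exists_translate_repr L e dV hdV dW hdW 𝒦 (hstd.2.1 0) (hcont 0)
  have hrepf : ∀ (s : ℂ) (y : HA L e dV hdV dW hdW), ∀ k ∈ (𝒦.K : Set (HA L e dV hdV dW hdW)),
      f s (y * k) = ∑ κ ∈ T, d κ k * f s (y * (κ : HA L e dV hdV dW hdW)) := fun s y k hk =>
    translate_repr_family L e dV hdV dW hdW 𝒦 hstd.1.1 (fun k hk s s' => hstd.2.2 k hk s s') hrep₀ s y hk
  -- `hrep` and `heqv` for `E`, transported from `a(s)·M(s)f_s` through `hEeq` on `re s > n/2`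
  have hrep : ∀ s : ℂ, (n : ℝ) / 2 < s.re → ∀ k ∈ (𝒦.K : Set (HA L e dV hdV dW hdW)),
      E s k = ∑ i : ↥T, E s ((i : ↥𝒦.K) : HA L e dV hdV dW hdW) * d i k := by
    intro s hs k hk
    rw [hEeq s k hs, intertwiningDelta_translate_repr L e dV hdV dW hdW hdV0 hdW0 𝒦 νN hχ hstd.1.1 hcont hrepf hs hk, Finset.mul_sum,
      ← Finset.sum_coe_sort]
    refine Finset.sum_congr rfl fun i _ => ?_
    rw [hEeq s _ hs]
    ring
  have heqv : ∀ s : ℂ, (n : ℝ) / 2 < s.re → ∀ p ∈ {p : HA L e dV hdV dW hdW | IsSiegelDelta L e dV hdV dW hdW p}, ∀ x : HA L e dV hdV dW hdW,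
      E s (p * x) = (((chiDet L e dV hdV dW hdW χ' p : ℂˣ) : ℂ) * ((modDelta L e dV hdV dW hdW p : ℝ) : ℂ) ^ (((n : ℝ) : ℂ) - 2 * s)) * E s x := by
    intro s hs p hp x
    rw [hEeq s _ hs, hEeq s x hs]
    exact intertwiningDelta_family_equivariant_of_conj L e dV hdV dW hdW hdV0 hdW0 νN χ χ' hχ' ((n : ℝ) / 2) f hstd.1.1 a s hs p hp x
  exact growth_of_equivariance_of_pointRepr (hIw_of_iwasawaDatum L e dV hdV dW hdW 𝒦)
    (fun x : HA L e dV hdV dW hdW => adelicHeightGL (n + n) L (x : GL (Fin (n + n)) (AdeleRing (𝓞 L) L))) (fun _ => adelicHeightGL_nonneg _)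
    hCK hPK (fun p _ => hωd_chiDet_modDelta L e dV hdV dW hdW χ' p _) (hω_chiDet_modDelta L e dV hdV dW hdW χ') hEd (by positivity) heqv
    (kpt := fun i : ↥T => ((i : ↥𝒦.K) : HA L e dV hdV dW hdW)) hrep hB (fun i k hk => hdB i k hk)

/-- the same with `χ′ := χʷ = reflectChar c χ` by name (★ `reflectChar_hχ'`): NO character letter. [cite: MoeglinWaldspurger1995, II.1.7] [cite: Garrett2018, §3.12] -/
theorem bigCell_growth_continued_reflect [NeZero n] (hdV0 : ∀ i, dV i ≠ 0) (hdW0 : ∀ i, dW i ≠ 0) (𝒦 : IwasawaDatum L e dV hdV dW hdW)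
    [MeasurableSpace (unipDelta L e dV hdV dW hdW)] [BorelSpace (unipDelta L e dV hdV dW hdW)]
    (νN : Measure (unipDelta L e dV hdV dW hdW)) [νN.IsHaarMeasure] (χ : HeckeCharacter L) (hχ : χ.IsUnitary)
    (f : ℂ → HA L e dV hdV dW hdW → ℂ) (hstd : IsStandardSectionFamily 𝒦 χ f) (hcont : ∀ s, Continuous (f s)) (a : ℂ → ℂ)
    (E : ℂ → HA L e dV hdV dW hdW → ℂ) (hEd : ∀ x : HA L e dV hdV dW hdW, DifferentiableOn ℂ (fun s : ℂ => E s x) {s : ℂ | 0 < s.re})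
    (hEeq : ∀ (s : ℂ) (x : HA L e dV hdV dW hdW), (n : ℝ) / 2 < s.re → E s x = a s * intertwiningDelta L e dV hdV dW hdW νN (f s) x) :
    ∀ z : ℂ, 0 < z.re → ∃ C A ρ : ℝ, 0 ≤ C ∧ 0 ≤ A ∧ 0 < ρ ∧ ∀ s : ℂ, dist s z < ρ → ∀ x : HA L e dV hdV dW hdW,
      ‖E s x‖ ≤ C * adelicHeightGL (n + n) L (x : GL (Fin (n + n)) (AdeleRing (𝓞 L) L)) ^ A :=
  bigCell_growth_continued L e dV hdV dW hdW hdV0 hdW0 𝒦 νN χ _ hχ (reflectChar_hχ' L χ) f hstd hcont a E hEd hEeq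

/-! ## §2 The big-cell term package `Ec₈` in the 4-clause currency of the #41 TOP -/

/-- `adelicHeightGL (n+n)` is bounded on compact subsets of `H(𝔸)` (★ `exists_adelicHeightGL_le_of_isCompact`). [cite: MoeglinWaldspurger1995, I.2.2] -/
theorem adelicHeightGL_bdd_on_compact (K : Set (HA L e dV hdV dW hdW)) (hK : IsCompact K) :
    ∃ B : ℝ, ∀ x ∈ K, adelicHeightGL (n + n) L (x : GL (Fin (n + n)) (AdeleRing (𝓞 L) L)) ≤ B := by
  obtain ⟨B, -, hB⟩ := exists_adelicHeightGL_le_of_isCompact (n := n + n) (K := L) (hK.image continuous_subtype_val)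
  exact ⟨B, fun x hx => hB _ (Set.mem_image_of_mem _ hx)⟩

/-- **THE BIG-CELL TERM PACKAGE `Ec₈`, INSTANTIATED.**  Data: the frame (`dV, dW ≠ 0`, `n ≠ 0`), an Iwasawa datum `𝒦`, a Haar measure `νN` on `N_Δ(𝔸)`, a unitary `χ`, a standard family
`f` with continuous members (socket #41's `hstd`, `hcont`); BY VALUE: the scalar normalisation — a finite pole set `P`, scalars `r, a : ℂ → ℂ` and `G` holomorphic on `{0 < re}` with
`(∏_{p∈P}(s−p))·r(s) = G(s)` and `r(s)·a(s) = 1` on `re s > n∕2` (Φ8-scalar row: `r = a^T∕b^T`-type ratio) — and the CONTINUATION `E` of the normalised big cell `a(s)·M(s)f_s`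
(`hEd`, `hEeq`).  CONCLUSION: a term package `Ec₈` with the four clauses (i) holomorphy on `{0<re}`, (ii) continuity in `h` for `0 < re s`, (iv) `Ec₈ s h = (∏_{p∈P}(s−p))·M(s)f_s(h)` on
`re s > n∕2`, (v) moderate growth in `adelicHeightGL (n+n)` locally uniformly on `{0<re}` — ★ `exists_bigCell_package` with `hMg` §1, `hBc` ★ `continuous_intertwiningDelta_family`.
[cite: Garrett2018, §3.10–§3.12] [cite: MoeglinWaldspurger1995, II.1.7, IV.1] [cite: KudlaSweet1997, §1] [cite: Tan1999, §3] -/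
theorem exists_bigCell_termPackage [NeZero n] (hdV0 : ∀ i, dV i ≠ 0) (hdW0 : ∀ i, dW i ≠ 0) (𝒦 : IwasawaDatum L e dV hdV dW hdW)
    [MeasurableSpace (unipDelta L e dV hdV dW hdW)] [BorelSpace (unipDelta L e dV hdV dW hdW)]
    (νN : Measure (unipDelta L e dV hdV dW hdW)) [νN.IsHaarMeasure] (χ : HeckeCharacter L) (hχ : χ.IsUnitary)
    (f : ℂ → HA L e dV hdV dW hdW → ℂ) (hstd : IsStandardSectionFamily 𝒦 χ f) (hcont : ∀ s, Continuous (f s))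
    (P : Finset ℂ) (r G : ℂ → ℂ) (hG : DifferentiableOn ℂ G {s : ℂ | 0 < s.re})
    (hrG : ∀ s : ℂ, (n : ℝ) / 2 < s.re → (∏ p ∈ P, (s - p)) * r s = G s)
    (a : ℂ → ℂ) (hra : ∀ s : ℂ, (n : ℝ) / 2 < s.re → r s * a s = 1)
    (E : ℂ → HA L e dV hdV dW hdW → ℂ) (hEd : ∀ x : HA L e dV hdV dW hdW, DifferentiableOn ℂ (fun s : ℂ => E s x) {s : ℂ | 0 < s.re})
    (hEeq : ∀ (s : ℂ) (x : HA L e dV hdV dW hdW), (n : ℝ) / 2 < s.re → E s x = a s * intertwiningDelta L e dV hdV dW hdW νN (f s) x) :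
    ∃ Ec₈ : ℂ → HA L e dV hdV dW hdW → ℂ,
      (∀ h : HA L e dV hdV dW hdW, DifferentiableOn ℂ (fun s => Ec₈ s h) {s : ℂ | 0 < s.re}) ∧
      (∀ s : ℂ, 0 < s.re → Continuous (Ec₈ s)) ∧
      (∀ (s : ℂ) (h : HA L e dV hdV dW hdW), (n : ℝ) / 2 < s.re →
        Ec₈ s h = (∏ p ∈ P, (s - p)) * intertwiningDelta L e dV hdV dW hdW νN (f s) h) ∧
      (∀ z : ℂ, 0 < z.re → ∃ C A ρ : ℝ, 0 < ρ ∧ ∀ s : ℂ, dist s z < ρ → ∀ h : HA L e dV hdV dW hdW,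
        ‖Ec₈ s h‖ ≤ C * adelicHeightGL (n + n) L (h : GL (Fin (n + n)) (AdeleRing (𝓞 L) L)) ^ A) :=
  exists_bigCell_package (fun x : HA L e dV hdV dW hdW => adelicHeightGL (n + n) L (x : GL (Fin (n + n)) (AdeleRing (𝓞 L) L)))
    (fun x => adelicHeightGL_pos_holds _) (adelicHeightGL_bdd_on_compact L e dV hdV dW hdW) P r G hG (by positivity) hrG E hEd
    (bigCell_growth_continued_reflect L e dV hdV dW hdW hdV0 hdW0 𝒦 νN χ hχ f hstd hcont a E hEd hEeq)
    (fun s h => intertwiningDelta L e dV hdV dW hdW νN (f s) h)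
    (continuous_intertwiningDelta_family L e dV hdV hdV0 dW hdW hdW0 νN hχ f hstd.1.1 hcont) fun s x hs => by
      rw [hEeq s x hs, ← mul_assoc, hra s hs, one_mul]

end Summit.HodgeConjecture.HodgeConjecture.Cruxes.HLiu418.K2LiuSiegelEisensteinBigCellTermPackage

end
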